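import Literature.AnabelianGeometry.EtaleTheta.Discharge.Sec2ClassTwoCommutators
import Mathlib.GroupTheory.Abelianization.Defs
import Mathlib.Tactic.LinearCombination
import HarnessLib

/-!
# Class-two normal forms: the commutator of `a^i b^j c` and `a^{i'} b^{j'} c'`, normal forms in a
# two-generated subgroup, and the `2 × 2` determinant step (helper file for "(Δ^tp_Y)^Θ is abelian")

Mochizuki, *The étale theta function and its Frobenioid-theoretic manifestations*, Publ. RIMS **45**
(2009) [EtTh], §1 PRIMS PDF p. 12: "`Δ_X` is a profinite free group on 2 generators … we also have a
natural exact sequence `1 → ∧² Δ^ell_X (≅ Ẑ(1)) → Δ^Θ_X → Δ^ell_X → 1`" [cite: MochizukiEtTh2009, §1 p.12];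
the commutator identities are the Witt–Hall identities, Magnus–Karrass–Solitar, *Combinatorial Group
Theory* (1966), §5.2 Thm 5.1 p. 290 [cite: MagnusKarrassSolitar1966, Thm 5.1 §5.2 p.290]. Layer L2 of the
abc-iut cell, seat abc-iut-L2-t8 (gen 2); continuation of `Sec2ClassTwoCommutators.lean` (seat
abc-iut-L5-t14), consumed by `Sec2DtpYThetaAbelian.lean`. THEOREMS ONLY, no definition, no named fact.

CONTENT (sub-namespace `DtpYAbelian`; relative to subgroups `A, K₂, K₃ ≤ G` with `[A, A] ≤ K₂ ≤ A`,
`[A, K₂] ≤ K₃`, `K₃` normal, as in `ClassTwo`):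
* `mk_commutator_eq_one_of_mem_right/left` — `[x, c] ≡ 1 ≡ [c, x]` mod `K₃` for `x ∈ A`, `c ∈ K₂`;
* `mk_commutator_normalForm` — `[a^i b^j c, a^{i'} b^{j'} c'] ≡ [a, b]^{i j' − j i'}` mod `K₃`;
* `exists_normalForm_of_mem_closure_pair` — every element of the subgroup generated by `a, b ∈ A` is
  `a^i b^j c` with `c ∈ [A, A]` (abelianisation);
* `det_eq_zero_of_unimodular` — in a commutative ring, two vectors orthogonal to a unimodular vector
  have vanishing `2 × 2` determinant.
HONEST FRAMING: classical group theory; nothing of [EtTh] is asserted here.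
-/

namespace Literature.AnabelianGeometry.EtaleTheta

open scoped commutatorElement
open ClassTwo

namespace DtpYAbelian

section Algebra

variable {G : Type*} [Group G] (A K₂ K₃ : Subgroup G) [K₃.Normal]

/-- `[x, c] ≡ 1 mod K₃` for `x ∈ A`, `c ∈ K₂` when `[A, K₂] ≤ K₃` (centrality of `K₂` modulo `K₃`).
[cite: MagnusKarrassSolitar1966, Thm 5.1 §5.2 p.290] -/
theorem mk_commutator_eq_one_of_mem_right (hAK : ⁅A, K₂⁆ ≤ K₃) {x c : G} (hx : x ∈ A)
    (hc : c ∈ K₂) : ((⁅x, c⁆ : G) : G ⧸ K₃) = 1 :=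
  (QuotientGroup.eq_one_iff _).mpr (hAK (Subgroup.commutator_mem_commutator hx hc))

/-- `[c, x] ≡ 1 mod K₃` for `x ∈ A`, `c ∈ K₂` when `[A, K₂] ≤ K₃`.
[cite: MagnusKarrassSolitar1966, Thm 5.1 §5.2 p.290] -/
theorem mk_commutator_eq_one_of_mem_left (hAK : ⁅A, K₂⁆ ≤ K₃) {x c : G} (hx : x ∈ A)
    (hc : c ∈ K₂) : ((⁅c, x⁆ : G) : G ⧸ K₃) = 1 := by
  rw [← commutatorElement_inv, QuotientGroup.mk_inv,
    mk_commutator_eq_one_of_mem_right A K₂ K₃ hAK hx hc, inv_one]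

/-- **The class-two commutator of two normal forms** (Witt–Hall): for `a, b ∈ A`, `c, c' ∈ K₂`,
`[a^i b^j c, a^{i'} b^{j'} c'] ≡ [a, b]^{i j' − j i'}` modulo `K₃` — bilinearity and alternation of the
commutator in the class-two quotient. [cite: MagnusKarrassSolitar1966, Thm 5.1 §5.2 p.290] -/
theorem mk_commutator_normalForm (hAA : ⁅A, A⁆ ≤ K₂) (hK₂A : K₂ ≤ A) (hAK : ⁅A, K₂⁆ ≤ K₃)
    {a b c c' : G} (ha : a ∈ A) (hb : b ∈ A) (hc : c ∈ K₂) (hc' : c' ∈ K₂) (i j i' j' : ℤ) :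
    ((⁅a ^ i * b ^ j * c, a ^ i' * b ^ j' * c'⁆ : G) : G ⧸ K₃) =
      (((⁅a, b⁆ : G) : G ⧸ K₃)) ^ (i * j' - j * i') := by
  have hai : a ^ i ∈ A := A.zpow_mem ha i
  have hbj : b ^ j ∈ A := A.zpow_mem hb j
  have hai' : a ^ i' ∈ A := A.zpow_mem ha i'
  have hbj' : b ^ j' ∈ A := A.zpow_mem hb j'
  have hcA : c ∈ A := hK₂A hc
  have hc'A : c' ∈ A := hK₂A hc'
  have hab' : a ^ i' * b ^ j' ∈ A := A.mul_mem hai' hbj'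
  have hw : a ^ i' * b ^ j' * c' ∈ A := A.mul_mem hab' hc'A
  rw [mk_commutator_mul_left A K₂ K₃ hAA hK₂A hAK (A.mul_mem hai hbj) hcA hw,
    mk_commutator_eq_one_of_mem_left A K₂ K₃ hAK hw hc, mul_one,
    mk_commutator_mul_left A K₂ K₃ hAA hK₂A hAK hai hbj hw,
    mk_commutator_mul_right A K₂ K₃ hAA hAK hai hab' hc'A,
    mk_commutator_eq_one_of_mem_right A K₂ K₃ hAK hai hc', mul_one,
    mk_commutator_mul_right A K₂ K₃ hAA hAK hai hai' hbj',
    mk_commutator_mul_right A K₂ K₃ hAA hAK hbj hab' hc'A,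
    mk_commutator_eq_one_of_mem_right A K₂ K₃ hAK hbj hc', mul_one,
    mk_commutator_mul_right A K₂ K₃ hAA hAK hbj hai' hbj']
  have h1 : (⁅a ^ i, a ^ i'⁆ : G) = 1 :=
    commutatorElement_eq_one_iff_commute.mpr ((Commute.refl a).zpow_zpow i i')
  have h2 : (⁅b ^ j, b ^ j'⁆ : G) = 1 :=
    commutatorElement_eq_one_iff_commute.mpr ((Commute.refl b).zpow_zpow j j')
  have hba : ((⁅b, a⁆ : G) : G ⧸ K₃) = (((⁅a, b⁆ : G) : G ⧸ K₃))⁻¹ := by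
    rw [← commutatorElement_inv, QuotientGroup.mk_inv]
  rw [h1, h2, QuotientGroup.mk_one, one_mul, mul_one,
    mk_commutator_zpow_left A K₂ K₃ hAA hK₂A hAK ha hbj' i,
    mk_commutator_zpow_right A K₂ K₃ hAA hAK ha hb j',
    mk_commutator_zpow_left A K₂ K₃ hAA hK₂A hAK hb hai' j,
    mk_commutator_zpow_right A K₂ K₃ hAA hAK hb ha i', hba, inv_zpow, inv_zpow, ← zpow_mul,
    ← zpow_mul, ← zpow_neg, ← zpow_add]
  congr 1
  ring

/-- **Normal form in a subgroup generated by two elements**: if `a, b ∈ A` then every element of the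
subgroup generated by `a` and `b` is `a^i b^j c` with `c ∈ [A, A]` (abelianisation).
[cite: MagnusKarrassSolitar1966, Thm 5.1 §5.2 p.290] -/
theorem exists_normalForm_of_mem_closure_pair {a b : G} (ha : a ∈ A) (hb : b ∈ A) {x : G}
    (hx : x ∈ Subgroup.closure ({a, b} : Set G)) :
    ∃ i j : ℤ, ∃ c ∈ ⁅A, A⁆, x = a ^ i * b ^ j * c := by
  let a' : A := ⟨a, ha⟩
  let b' : A := ⟨b, hb⟩
  have hcl : Subgroup.closure ({a, b} : Set G) =
      (Subgroup.closure ({a', b'} : Set A)).map A.subtype := by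
    rw [MonoidHom.map_closure, Set.image_pair]
    rfl
  rw [hcl] at hx
  obtain ⟨y, hy, rfl⟩ := hx
  have hy' : Abelianization.of y ∈
      (Subgroup.closure ({a', b'} : Set A)).map (Abelianization.of (G := A)) :=
    Subgroup.mem_map_of_mem _ hy
  rw [MonoidHom.map_closure, Set.image_pair] at hy'
  obtain ⟨m, n, hmn⟩ := Subgroup.mem_closure_pair.mp hy'
  have hker : (a' ^ m * b' ^ n)⁻¹ * y ∈ commutator A := by
    rw [← Abelianization.ker_of, MonoidHom.mem_ker, map_mul, map_inv, map_mul, map_zpow, map_zpow,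
      hmn, inv_mul_cancel]
  refine ⟨m, n, A.subtype ((a' ^ m * b' ^ n)⁻¹ * y), ?_, ?_⟩
  · have hmap : (commutator A).map A.subtype = ⁅A, A⁆ := by
      rw [commutator_def, Subgroup.map_commutator, ← MonoidHom.range_eq_map, Subgroup.range_subtype]
    rw [← hmap]
    exact Subgroup.mem_map_of_mem _ hker
  · simp only [Subgroup.coe_subtype, Subgroup.coe_mul, Subgroup.coe_inv, SubgroupClass.coe_zpow,
      mul_inv_cancel_left, a', b']

/-- The `2 × 2` determinant step: in a commutative ring, if `(i, j)` and `(i', j')` are orthogonal to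
`(σ, τ)` and `(σ, τ)` is unimodular (`i₁ σ + j₁ τ = 1`), then `i j' − j i' = 0` (the linear algebra of
"`∧² Δ^ell_X (≅ Ẑ(1))`", p. 12, read in the finite quotients `ℤ/Nℤ`). [cite: MochizukiEtTh2009, §1 p.12] -/
theorem det_eq_zero_of_unimodular {R : Type*} [CommRing R] {σ τ i j i' j' i₁ j₁ : R}
    (h1 : i * σ + j * τ = 0) (h2 : i' * σ + j' * τ = 0) (h3 : i₁ * σ + j₁ * τ = 1) :
    i * j' - j * i' = 0 := by
  linear_combination (i₁ * j' - j₁ * i') * h1 + (j₁ * i - i₁ * j) * h2 - (i * j' - j * i') * h3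

end Algebra

end DtpYAbelian

end Literature.AnabelianGeometry.EtaleTheta
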